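import Literature.Barriers.ValiantsHypothesis.BDGIL24IsotypicNaturalProofs
import Literature.Computability.AlgebraicComplexity.OrbitClosureWeights
import Literature.Computability.AlgebraicComplexity.ArithCircuitProofs
import Mathlib.LinearAlgebra.Vandermonde

/-!
# van den Berg–Dutta–Gesmundo–Ikenmeyer–Lysikov 2024, Theorem 1.1 (1) — PROVED
# (`BergEtAl2024.thm_1_1_weight_holds`)

Discharge of the named fact `BergEtAl2024.thm_1_1_weight` of `BDGIL24IsotypicNaturalProofs.lean`
(val-lit row vdBDGIL24-A; M. van den Berg, P. Dutta, F. Gesmundo, C. Ikenmeyer, V. Lysikov,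
*Algebraic metacomplexity and representation theory*, arXiv:2411.03444, Thm. 1.1 (1)): the
projection of a metapolynomial `Δ` of format `(δ, d, k)` with `cc(Δ) ≤ s` onto the weight space
of any torus weight has `cc ≤ C · s · (δd)^{2k³}` (here `C = 3`),
[cite: BergEtAl2024, Thm. 1.1 (1), p.4 (PDF p.5)].

The proof formalised here is the classical torus-interpolation argument (the paper proves the
finer bounds of Thm. 1.1 through the Lie algebra action, §4; for item (1) interpolation over the
torus suffices): a metamonomial `c^s` is a weight vector of weight `monWeight s` (tree
`coordSubst_monomial_of_isDiagonalGL`), whose `i`-th coordinate is `-nᵢ(s)` with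
`0 ≤ nᵢ(s) ≤ δd`; acting by the diagonal torus elements `diag(α_{J₁}, …, α_{J_k})`,
`J ∈ {0, …, δd}^k`, `α_j = j + 2`, and taking the inverse-Vandermonde combination isolates the
metamonomials with prescribed `(n₁, …, n_k)`, i.e. the weight-`χ` part `Δ_χ`. Each torus translate
has `cc ≤ cc(Δ)` because `cc` allows affine forms at the inputs and the torus acts by a linear
substitution of the metavariables; summing `(δd+1)^k` translates costs `≤ (δd+1)^k (s + 2) ≤
3 s (δd)^{2k³}` gates (for `δ ≥ 2`; for `δ ≤ 1` or `cc(Δ) = 0` the projection is affine-linear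
and free). The `cc` calculus (`affComplexity`, §2.1) is developed first.

Theorem-only file (no definitions). Honest framing: a discharge of typed literature (net debt −1);
VP ≠ VNP is NOT proved and nothing here is progress on it.

## References
* [BergEtAl2024] M. van den Berg, P. Dutta, F. Gesmundo, C. Ikenmeyer, V. Lysikov,
  arXiv:2411.03444 (2024), §2.1 (the measure `cc`), Thm. 1.1 (1), §4 (weight projections).
* [Burgisser2000] P. Bürgisser, *Completeness and Reduction in Algebraic Complexity Theory*,
  Def. 2.1, §2.1 (circuit size calculus; tree `ArithCircuit*`).
-/

noncomputable section

open MvPolynomial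
open scoped BigOperators

namespace Literature.Barriers.ValiantsHypothesis

namespace BergEtAl2024

open Literature.Computability.AlgebraicComplexity Literature.NumberTheory.DiophantineGeometry

/-! ### Affine-linear polynomials -/

section Affine

variable {R : Type*} [CommSemiring R] {σ τ : Type*}

/-- Substituting polynomials of total degree `≤ 1` does not increase total degree
(elementary; the reason `cc` is well behaved under affine substitution, §2.1).
[cite: BergEtAl2024, §2.1, p.6 (PDF p.7)] -/
theorem totalDegree_aeval_le_of_forall_le_one (p : MvPolynomial σ R) {θ : σ → MvPolynomial τ R}
    (hθ : ∀ i, (θ i).totalDegree ≤ 1) : (aeval θ p).totalDegree ≤ p.totalDegree := by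
  classical
  rw [MvPolynomial.aeval_eq_bind₁]
  have hsum : MvPolynomial.bind₁ θ p =
      ∑ e ∈ p.support, MvPolynomial.bind₁ θ (monomial e (coeff e p)) := by
    conv_lhs => rw [p.as_sum]
    rw [map_sum]
  rw [hsum]
  refine totalDegree_finsetSum_le fun e he => ?_
  rw [bind₁_monomial]
  refine (totalDegree_mul _ _).trans ?_
  rw [totalDegree_C, zero_add]
  refine (totalDegree_finsetProd _ _).trans ?_
  refine le_trans (Finset.sum_le_sum fun i _ => (totalDegree_pow _ _).trans
    (Nat.mul_le_mul_left (e i) (hθ i))) ?_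
  simp only [mul_one]
  exact le_totalDegree he

/-- A variable has total degree `≤ 1` (also over the trivial ring); private copy of
`Literature.Computability.Complexity.Shen.totalDegree_X_le'` (not imported). [folklore] -/
private theorem totalDegree_X_le_one'' (i : σ) : (X i : MvPolynomial σ R).totalDegree ≤ 1 := by
  rcases subsingleton_or_nontrivial R with hR | hR
  · rw [Subsingleton.elim (X i : MvPolynomial σ R) 0, totalDegree_zero]
    exact zero_le_one
  · rw [totalDegree_X]

/-- A linear combination `Σ aᵢ • X (eᵢ)` has total degree `≤ 1`.
[cite: BergEtAl2024, §2.1, p.6 (PDF p.7)] -/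
theorem totalDegree_sum_smul_X_le_one {ι : Type*} (s : Finset ι) (a : ι → R) (e : ι → σ) :
    (∑ i ∈ s, a i • (X (e i) : MvPolynomial σ R)).totalDegree ≤ 1 :=
  totalDegree_finsetSum_le fun i _ =>
    (totalDegree_smul_le (a i) _).trans (totalDegree_X_le_one'' (e i))

end Affine

/-! ### The `cc` calculus (`affComplexity`) -/

section CC

variable {τ : Type*} [Fintype τ]

/-- The infimum defining `cc(F)` is attained: an optimal presentation `F = G(ℓ)` with affine
`ℓ`. [cite: BergEtAl2024, §2.1, p.6 (PDF p.7)] -/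
theorem exists_presentation_affComplexity (F : MvPolynomial τ ℂ) :
    ∃ (m : ℕ) (G : MvPolynomial (Fin m) ℂ) (ℓ : Fin m → MvPolynomial τ ℂ),
      (∀ i, (ℓ i).totalDegree ≤ 1) ∧ aeval ℓ G = F ∧ complexity G = affComplexity F := by
  classical
  have hne : {s | ∃ (m : ℕ) (G : MvPolynomial (Fin m) ℂ) (ℓ : Fin m → MvPolynomial τ ℂ),
      (∀ i, (ℓ i).totalDegree ≤ 1) ∧ aeval ℓ G = F ∧ complexity G = s}.Nonempty := by
    refine ⟨complexity (renameEquiv ℂ (Fintype.equivFin τ) F), Fintype.card τ,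
      renameEquiv ℂ (Fintype.equivFin τ) F, fun i => X ((Fintype.equivFin τ).symm i),
      fun i => totalDegree_X_le_one'' _, ?_, rfl⟩
    rw [renameEquiv_apply, aeval_rename]
    have : ((fun i => X ((Fintype.equivFin τ).symm i)) ∘ (Fintype.equivFin τ) :
        τ → MvPolynomial τ ℂ) = X := funext fun _ => by simp
    rw [this, aeval_X_left, AlgHom.coe_id, id_eq]
  obtain ⟨m, G, ℓ, h1, h2, h3⟩ := Nat.sInf_mem hne
  exact ⟨m, G, ℓ, h1, h2, h3⟩

omit [Fintype τ] in
/-- A presentation bounds `cc`. [cite: BergEtAl2024, §2.1, p.6 (PDF p.7)] -/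
theorem affComplexity_le_of_presentation {F : MvPolynomial τ ℂ} {m : ℕ}
    (G : MvPolynomial (Fin m) ℂ) (ℓ : Fin m → MvPolynomial τ ℂ) (hℓ : ∀ i, (ℓ i).totalDegree ≤ 1)
    (hG : aeval ℓ G = F) : affComplexity F ≤ complexity G :=
  Nat.sInf_le ⟨m, G, ℓ, hℓ, hG, rfl⟩

omit [Fintype τ] in
/-- **Affine-linear polynomials are free**: `cc(F) = 0` if `deg F ≤ 1` ("we allow affine linear
forms at the input gates", §2.1). [cite: BergEtAl2024, §2.1, p.6 (PDF p.7)] -/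
theorem affComplexity_eq_zero_of_totalDegree_le_one {F : MvPolynomial τ ℂ}
    (hF : F.totalDegree ≤ 1) : affComplexity F = 0 := by
  refine Nat.le_zero.1 ?_
  have h := Nat.sInf_le (s := {s | ∃ (m : ℕ) (G : MvPolynomial (Fin m) ℂ)
      (ℓ : Fin m → MvPolynomial τ ℂ), (∀ i, (ℓ i).totalDegree ≤ 1) ∧ aeval ℓ G = F ∧
      complexity G = s}) ⟨1, X 0, fun _ => F, fun _ => hF, by simp, rfl⟩
  rw [complexity_X_holds] at h
  exact h

/-- A polynomial of circuit complexity `0` is a variable, a constant, or `0`: it has total degree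
`≤ 1` (a circuit without gates outputs an input). [cite: Burgisser2000, Def. 2.1] -/
theorem totalDegree_le_one_of_complexity_eq_zero {σ : Type*} {G : MvPolynomial σ ℂ}
    (hG : complexity G = 0) : G.totalDegree ≤ 1 := by
  obtain ⟨P, -, hP2, hP3⟩ := ArithCircuit.exists_computes_size_eq_complexity G
  rw [hG, ArithCircuit.size, List.length_eq_zero_iff] at hP3
  rw [ArithCircuit.Computes, ArithCircuit.eval, hP3] at hP2
  rw [← hP2]
  cases P.output with
  | var i => exact totalDegree_X_le_one'' _
  | const c =>
    simp only [ArithCircuit.Operand.eval, totalDegree_C]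
    exact Nat.zero_le _
  | gate j =>
    simp only [ArithCircuit.Operand.eval, ArithCircuit.gateValues, List.foldl_nil,
      List.getD_eq_getElem?_getD, List.getElem?_nil, Option.getD_none, totalDegree_zero]
    exact Nat.zero_le _

/-- `cc(F) = 0` only for affine-linear `F`. [cite: BergEtAl2024, §2.1, p.6 (PDF p.7)] -/
theorem totalDegree_le_one_of_affComplexity_eq_zero {F : MvPolynomial τ ℂ}
    (hF : affComplexity F = 0) : F.totalDegree ≤ 1 := by
  obtain ⟨m, G, ℓ, hℓ, hGF, hG⟩ := exists_presentation_affComplexity F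
  rw [hF] at hG
  rw [← hGF]
  exact (totalDegree_aeval_le_of_forall_le_one G hℓ).trans
    (totalDegree_le_one_of_complexity_eq_zero hG)

/-- **`cc` does not increase under linear (indeed affine) substitution of the variables** (the
invariance of `cc`, §2.1: substitute into the input forms). [cite: BergEtAl2024, §2.1, p.6 (PDF p.7)] -/
theorem affComplexity_aeval_le_of_forall_le_one {τ' : Type*} [Fintype τ'] (F : MvPolynomial τ ℂ)
    {φ : τ → MvPolynomial τ' ℂ} (hφ : ∀ i, (φ i).totalDegree ≤ 1) :
    affComplexity (aeval φ F) ≤ affComplexity F := by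
  obtain ⟨m, G, ℓ, hℓ, hGF, hG⟩ := exists_presentation_affComplexity F
  rw [← hG]
  refine affComplexity_le_of_presentation G (fun i => aeval φ (ℓ i)) (fun i => ?_) ?_
  · exact (totalDegree_aeval_le_of_forall_le_one (ℓ i) hφ).trans (hℓ i)
  · rw [← hGF, ← AlgHom.comp_apply, MvPolynomial.comp_aeval]

/-- **Subadditivity**: `cc(F + G) ≤ cc(F) + cc(G) + 1` (juxtapose optimal presentations on
disjoint variable sets and add the outputs). [cite: BergEtAl2024, §2.1, p.6 (PDF p.7)] -/
theorem affComplexity_add_le (F G : MvPolynomial τ ℂ) :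
    affComplexity (F + G) ≤ affComplexity F + affComplexity G + 1 := by
  obtain ⟨m₁, G₁, ℓ₁, hℓ₁, hF₁, hc₁⟩ := exists_presentation_affComplexity F
  obtain ⟨m₂, G₂, ℓ₂, hℓ₂, hF₂, hc₂⟩ := exists_presentation_affComplexity G
  have hpres : aeval (Fin.append ℓ₁ ℓ₂)
      (rename (Fin.castAdd m₂) G₁ + rename (Fin.natAdd m₁) G₂) = F + G := by
    rw [map_add, aeval_rename, aeval_rename]
    have h1 : (Fin.append ℓ₁ ℓ₂ ∘ Fin.castAdd m₂ : Fin m₁ → MvPolynomial τ ℂ) = ℓ₁ :=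
      funext fun i => Fin.append_left ℓ₁ ℓ₂ i
    have h2 : (Fin.append ℓ₁ ℓ₂ ∘ Fin.natAdd m₁ : Fin m₂ → MvPolynomial τ ℂ) = ℓ₂ :=
      funext fun i => Fin.append_right ℓ₁ ℓ₂ i
    rw [h1, h2, hF₁, hF₂]
  refine (affComplexity_le_of_presentation _ _ (fun i => ?_) hpres).trans ?_
  · refine Fin.addCases (fun j => ?_) (fun j => ?_) i
    · rw [Fin.append_left]; exact hℓ₁ j
    · rw [Fin.append_right]; exact hℓ₂ j
  · refine (complexity_add_le_holds _ _).trans ?_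
    rw [← hc₁, ← hc₂]
    exact Nat.add_le_add_right (Nat.add_le_add (complexity_rename_le_holds' _ _)
      (complexity_rename_le_holds' _ _)) 1

/-- **Scalars**: `cc(a • F) ≤ cc(F) + 1`. [cite: BergEtAl2024, §2.1, p.6 (PDF p.7)] -/
theorem affComplexity_smul_le (a : ℂ) (F : MvPolynomial τ ℂ) :
    affComplexity (a • F) ≤ affComplexity F + 1 := by
  obtain ⟨m, G, ℓ, hℓ, hF, hc⟩ := exists_presentation_affComplexity F
  refine (affComplexity_le_of_presentation (a • G) ℓ hℓ (by rw [map_smul, hF])).trans ?_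
  rw [← hc]
  exact complexity_smul_le_holds a G

/-- **Linear combinations**: `cc(Σ_{j ∈ T} a_j • F_j) ≤ Σ_{j ∈ T} (cc(F_j) + 2)`.
[cite: BergEtAl2024, §2.1, p.6 (PDF p.7)] -/
theorem affComplexity_sum_smul_le {ι : Type*} (T : Finset ι) (a : ι → ℂ)
    (F : ι → MvPolynomial τ ℂ) :
    affComplexity (∑ j ∈ T, a j • F j) ≤ ∑ j ∈ T, (affComplexity (F j) + 2) := by
  classical
  induction T using Finset.induction_on with
  | empty =>
    rw [Finset.sum_empty, Finset.sum_empty]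
    have h0 : (0 : MvPolynomial τ ℂ).totalDegree ≤ 1 := by
      rw [totalDegree_zero]; exact Nat.zero_le _
    exact (affComplexity_eq_zero_of_totalDegree_le_one h0).le
  | insert j T hj ih =>
    rw [Finset.sum_insert hj, Finset.sum_insert hj]
    refine (affComplexity_add_le _ _).trans ?_
    have h1 := affComplexity_smul_le (a j) (F j)
    omega

end CC


/-! ### The weight part of a metapolynomial -/

section WeightPart

variable {k d : ℕ}

/-- Metamonomials are torus weight vectors: a diagonal `t` acts on the weight part
`∑_{wt(s) = χ} Δ_s c^s` trivially as on the monomials. The weight part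
`∑_{s : monWeight s = χ} Δ_s c^s` lies in the weight space `V_χ`
(as in `BergEtAl2024.exists_weight_decomposition`). [cite: BergEtAl2024, Thm. 1.1 (1), p.4 (PDF p.5)] -/
theorem weightPart_mem_weightSpace (Δ : MvPolynomial (DegIdx (Fin k) d) ℂ) (χ : Weight (Fin k)) :
    (∑ s ∈ Δ.support with monWeight s = χ, monomial s (coeff s Δ)) ∈
      weightSpace (coordRep (Fin k) ℂ d) χ := by
  classical
  refine Submodule.sum_mem _ fun s hs => ?_
  rw [(Finset.mem_filter.1 hs).2.symm]
  intro t ht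
  rw [coordRep_apply, coordSubst_monomial_of_isDiagonalGL ht]

/-- The remainder `Δ - Δ_χ` lies in the sum of the other weight spaces.
[cite: BergEtAl2024, Thm. 1.1 (1), p.4 (PDF p.5)] -/
theorem sub_weightPart_mem (Δ : MvPolynomial (DegIdx (Fin k) d) ℂ) (χ : Weight (Fin k)) :
    Δ - (∑ s ∈ Δ.support with monWeight s = χ, monomial s (coeff s Δ)) ∈
      ⨆ χ' ∈ {χ' : Weight (Fin k) | χ' ≠ χ}, weightSpace (coordRep (Fin k) ℂ d) χ' := by
  classical
  have hmon : ∀ (s : DegIdx (Fin k) d →₀ ℕ) (c : ℂ),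
      (monomial s c : MvPolynomial (DegIdx (Fin k) d) ℂ) ∈
        weightSpace (coordRep (Fin k) ℂ d) (monWeight s) := by
    intro s c t ht
    rw [coordRep_apply, coordSubst_monomial_of_isDiagonalGL ht]
  have hsplit : Δ - ∑ s ∈ Δ.support with monWeight s = χ, monomial s (coeff s Δ) =
      ∑ s ∈ Δ.support with monWeight s ≠ χ, monomial s (coeff s Δ) := by
    rw [sub_eq_iff_eq_add]
    conv_lhs => rw [Δ.as_sum]
    rw [← Finset.sum_filter_add_sum_filter_not Δ.support (fun s => monWeight s = χ), add_comm]
  rw [hsplit]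
  refine Submodule.sum_mem _ fun s hs => ?_
  have hne : monWeight s ≠ χ := (Finset.mem_filter.1 hs).2
  exact Submodule.mem_iSup_of_mem (monWeight s)
    (Submodule.mem_iSup_of_mem (show monWeight s ∈ {χ' : Weight (Fin k) | χ' ≠ χ} from hne)
      (hmon s _))

/-- The weight part consists of monomials of `Δ`, so its total degree is at most that of `Δ`.
[cite: BergEtAl2024, Thm. 1.1 (1), p.4 (PDF p.5)] -/
theorem totalDegree_weightPart_le (Δ : MvPolynomial (DegIdx (Fin k) d) ℂ) (χ : Weight (Fin k)) :
    (∑ s ∈ Δ.support with monWeight s = χ, monomial s (coeff s Δ)).totalDegree ≤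
      Δ.totalDegree := by
  classical
  refine totalDegree_finsetSum_le fun s hs => ?_
  refine (totalDegree_monomial_le _ _).trans ?_
  exact le_totalDegree (Finset.mem_filter.1 hs).1

/-- The torus acts on `Δ` monomial by monomial: for diagonal `t`,
`t · Δ = ∑_s χ_{wt(s)}(t) Δ_s c^s`. [cite: BergEtAl2024, §4 (Claim 4.2), p.13 (PDF p.14)] -/
theorem coordRep_of_isDiagonalGL_eq_sum (Δ : MvPolynomial (DegIdx (Fin k) d) ℂ)
    {t : GL (Fin k) ℂ} (ht : IsDiagonalGL t) :
    coordRep (Fin k) ℂ d t Δ =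
      ∑ s ∈ Δ.support, weightChar (monWeight s) t • monomial s (coeff s Δ) := by
  classical
  conv_lhs => rw [Δ.as_sum]
  rw [map_sum]
  refine Finset.sum_congr rfl fun s _ => ?_
  rw [coordRep_apply, coordSubst_monomial_of_isDiagonalGL ht]

/-- A torus translate costs no more than `Δ` itself: `cc(t · Δ) ≤ cc(Δ)` (the action is a
linear substitution of the metavariables; `cc` is an invariant complexity measure, §2.1).
[cite: BergEtAl2024, §2.1, p.6 (PDF p.7)] -/
theorem affComplexity_coordRep_le (Δ : MvPolynomial (DegIdx (Fin k) d) ℂ) (g : GL (Fin k) ℂ) :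
    affComplexity (coordRep (Fin k) ℂ d g Δ) ≤ affComplexity Δ := by
  classical
  rw [coordRep_apply]
  unfold coordSubst
  exact affComplexity_aeval_le_of_forall_le_one Δ fun μ =>
    totalDegree_sum_smul_X_le_one Finset.univ _ id

/-- The `i`-th occupation number `nᵢ(s) = ∑_μ s(μ) μᵢ` of a metamonomial of degree `δ` is at most
`δ d` (each `μ` has `|μ| = d`); its weight is `-nᵢ(s)`. [cite: BergEtAl2024, §4 (Claim 4.2), p.13 (PDF p.14)] -/
theorem occupation_le {δ : ℕ} {Δ : MvPolynomial (DegIdx (Fin k) d) ℂ} (hΔ : Δ.IsHomogeneous δ)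
    {s : DegIdx (Fin k) d →₀ ℕ} (hs : s ∈ Δ.support) (i : Fin k) :
    ∑ μ ∈ s.support, s μ * μ.1 i ≤ δ * d := by
  have hdeg : ∑ μ ∈ s.support, s μ = δ := (hΔ.degree_eq_sum_deg_support hs).symm
  calc ∑ μ ∈ s.support, s μ * μ.1 i ≤ ∑ μ ∈ s.support, s μ * d := by
        refine Finset.sum_le_sum fun μ _ => Nat.mul_le_mul_left _ ?_
        have hμ : μ.1.degree = d := mem_degMonomials_iff.1 μ.2
        have h := Finsupp.le_degree i μ.1
        rwa [hμ] at h
    _ = δ * d := by rw [← Finset.sum_mul, hdeg]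

end WeightPart

/-! ### Torus interpolation -/

section Interpolation

variable {k d : ℕ}

/-- **One-dimensional interpolation** (inverse Vandermonde): for distinct nodes `x₀, …, x_M`,
`∑_j (V⁻¹)_{ν j} x_j^n = [ν = n]`. [cite: BergEtAl2024, Thm. 1.1 (1) (proof technique), p.4 (PDF p.5)] -/
theorem vandermonde_inv_mul_pow {M : ℕ} (x : Fin (M + 1) → ℂ) (hx : Function.Injective x)
    (ν n : Fin (M + 1)) :
    ∑ j, (Matrix.vandermonde x)⁻¹ ν j * x j ^ (n : ℕ) = if ν = n then 1 else 0 := by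
  have hdet : (Matrix.vandermonde x).det ≠ 0 := Matrix.det_vandermonde_ne_zero_iff.2 hx
  have h := Matrix.nonsing_inv_mul (Matrix.vandermonde x) (isUnit_iff_ne_zero.2 hdet)
  have h2 := congr_fun (congr_fun h ν) n
  rw [Matrix.mul_apply, Matrix.one_apply] at h2
  simpa [Matrix.vandermonde_apply] using h2

/-- **`k`-dimensional interpolation**: with coefficients `c_J = ∏_i (V⁻¹)_{νᵢ, Jᵢ}` over the grid
`J ∈ {0, …, M}^k`, `∑_J c_J ∏_i x_{Jᵢ}^{nᵢ} = [ν = n]` for `nᵢ ≤ M`.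
[cite: BergEtAl2024, Thm. 1.1 (1) (proof technique), p.4 (PDF p.5)] -/
theorem grid_interpolation {M : ℕ} (x : Fin (M + 1) → ℂ) (hx : Function.Injective x)
    (ν : Fin k → Fin (M + 1)) (n : Fin k → ℕ) (hn : ∀ i, n i ≤ M) :
    ∑ J : Fin k → Fin (M + 1), (∏ i, (Matrix.vandermonde x)⁻¹ (ν i) (J i)) * (∏ i, x (J i) ^ n i) =
      if (∀ i, (ν i : ℕ) = n i) then 1 else 0 := by
  classical
  have key : ∑ J : Fin k → Fin (M + 1), (∏ i, (Matrix.vandermonde x)⁻¹ (ν i) (J i)) *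
      (∏ i, x (J i) ^ n i) =
      ∏ i, ∑ j, (Matrix.vandermonde x)⁻¹ (ν i) j * x j ^ n i := by
    rw [Fintype.prod_sum]
    refine Finset.sum_congr rfl fun J _ => ?_
    rw [← Finset.prod_mul_distrib]
  rw [key]
  have h1 : ∀ i, ∑ j, (Matrix.vandermonde x)⁻¹ (ν i) j * x j ^ n i =
      if (ν i : ℕ) = n i then 1 else 0 := by
    intro i
    have := vandermonde_inv_mul_pow x hx (ν i) ⟨n i, Nat.lt_succ_of_le (hn i)⟩
    simp only [Fin.ext_iff] at this
    exact this
  simp_rw [h1]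
  rw [Fintype.prod_boole]
  congr 1

/-- The diagonal torus element `diag(β)` (`βᵢ ≠ 0`) acts on a metamonomial of weight
`monWeight s` by `∏_i βᵢ^{wt(s)ᵢ} = ∏_i (βᵢ⁻¹)^{nᵢ(s)}`.
[cite: BergEtAl2024, §4 (Claim 4.2), p.13 (PDF p.14)] -/
theorem weightChar_monWeight_diag (β : Fin k → ℂ) (hβ : (Matrix.diagonal β).det ≠ 0)
    (s : DegIdx (Fin k) d →₀ ℕ) :
    weightChar (monWeight s) (Matrix.GeneralLinearGroup.mkOfDetNeZero (Matrix.diagonal β) hβ) =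
      ∏ i, (β i)⁻¹ ^ (∑ μ ∈ s.support, s μ * μ.1 i) := by
  classical
  unfold weightChar
  refine Finset.prod_congr rfl fun i _ => ?_
  rw [Matrix.GeneralLinearGroup.val_mkOfDetNeZero, Matrix.diagonal_apply_eq, monWeight_apply,
    zpow_neg, ← inv_zpow, zpow_natCast]

/-- The diagonal element `diag(β)` with nonzero entries is a torus element.
[cite: BergEtAl2024, §4, p.13 (PDF p.14)] -/
theorem isDiagonalGL_mkOfDetNeZero_diagonal (β : Fin k → ℂ) (hβ : (Matrix.diagonal β).det ≠ 0) :
    IsDiagonalGL (Matrix.GeneralLinearGroup.mkOfDetNeZero (Matrix.diagonal β) hβ) := by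
  rw [isDiagonalGL_iff_isDiag, Matrix.GeneralLinearGroup.val_mkOfDetNeZero]
  exact Matrix.isDiag_diagonal β

/-- **The weight part as a torus interpolation.** Let `Δ` be homogeneous of degree `δ`,
`M = δ d`, nodes `x_j = (j+2)⁻¹` (`α_j = j + 2`), and `χ = -ν` with `ν ∈ {0,…,M}^k`. Then
`Δ_χ = ∑_{J} (∏_i (V⁻¹)_{νᵢ Jᵢ}) · diag(α_{J₁}, …, α_{J_k}) · Δ`.
[cite: BergEtAl2024, Thm. 1.1 (1), p.4 (PDF p.5)] -/
theorem weightPart_eq_sum_coordRep {δ : ℕ} (Δ : MvPolynomial (DegIdx (Fin k) d) ℂ)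
    (hΔ : Δ.IsHomogeneous δ) (ν : Fin k → Fin (δ * d + 1))
    (hdet : ∀ J : Fin k → Fin (δ * d + 1),
      (Matrix.diagonal fun i => ((J i : ℕ) : ℂ) + 2).det ≠ 0) :
    (∑ s ∈ Δ.support with monWeight s = fun i => -((ν i : ℕ) : ℤ), monomial s (coeff s Δ)) =
      ∑ J : Fin k → Fin (δ * d + 1),
        (∏ i, (Matrix.vandermonde fun j : Fin (δ * d + 1) => (((j : ℕ) : ℂ) + 2)⁻¹)⁻¹ (ν i) (J i)) •
          coordRep (Fin k) ℂ d
            (Matrix.GeneralLinearGroup.mkOfDetNeZero (Matrix.diagonal fun i => ((J i : ℕ) : ℂ) + 2)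
              (hdet J)) Δ := by
  classical
  set x : Fin (δ * d + 1) → ℂ := fun j => (((j : ℕ) : ℂ) + 2)⁻¹ with hx
  have hxinj : Function.Injective x := by
    intro a b hab
    simp only [hx, inv_inj, add_left_inj, Nat.cast_inj] at hab
    exact Fin.ext hab
  -- expand every translate monomialwise and swap the sums
  have hrhs : ∑ J : Fin k → Fin (δ * d + 1), (∏ i, (Matrix.vandermonde x)⁻¹ (ν i) (J i)) •
      coordRep (Fin k) ℂ d (Matrix.GeneralLinearGroup.mkOfDetNeZero
        (Matrix.diagonal fun i => ((J i : ℕ) : ℂ) + 2) (hdet J)) Δ =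
      ∑ s ∈ Δ.support, (∑ J : Fin k → Fin (δ * d + 1),
        (∏ i, (Matrix.vandermonde x)⁻¹ (ν i) (J i)) * ∏ i, x (J i) ^ (∑ μ ∈ s.support, s μ * μ.1 i)) •
          monomial s (coeff s Δ) := by
    simp_rw [coordRep_of_isDiagonalGL_eq_sum Δ (isDiagonalGL_mkOfDetNeZero_diagonal _ (hdet _)),
      weightChar_monWeight_diag, Finset.smul_sum, smul_smul]
    rw [Finset.sum_comm]
    refine Finset.sum_congr rfl fun s _ => ?_
    rw [← Finset.sum_smul]
  rw [hrhs]
  -- the interpolation identity selects the monomials of weight `χ`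
  rw [Finset.sum_filter]
  refine Finset.sum_congr rfl fun s hs => ?_
  rw [grid_interpolation x hxinj ν _ fun i => occupation_le hΔ hs i]
  have hiff : (monWeight s = fun i => -((ν i : ℕ) : ℤ)) ↔ ∀ i, (ν i : ℕ) = ∑ μ ∈ s.support, s μ * μ.1 i := by
    constructor
    · intro h i
      have := congr_fun h i
      rw [monWeight_apply, neg_inj, Nat.cast_inj] at this
      exact this.symm
    · intro h
      funext i
      rw [monWeight_apply, h i]
  by_cases h : monWeight s = fun i => -((ν i : ℕ) : ℤ)
  · rw [if_pos h, if_pos (hiff.1 h), one_smul]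
  · rw [if_neg h, if_neg (fun h' => h (hiff.2 h')), zero_smul]

end Interpolation


/-! ### Theorem 1.1 (1) -/

section Final

variable {k d : ℕ}

/-- **Cost of the interpolation**: for a weight `χ = -ν` in the box `{0,…,δd}^k`,
`cc(Δ_χ) ≤ (δd+1)^k (s + 2)` whenever `cc(Δ) ≤ s`.
[cite: BergEtAl2024, Thm. 1.1 (1), p.4 (PDF p.5)] -/
theorem affComplexity_weightPart_le_of_box {δ s : ℕ} (Δ : MvPolynomial (DegIdx (Fin k) d) ℂ)
    (hΔ : Δ.IsHomogeneous δ) (hs : affComplexity Δ ≤ s) (ν : Fin k → Fin (δ * d + 1)) :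
    affComplexity
        (∑ s' ∈ Δ.support with monWeight s' = fun i => -((ν i : ℕ) : ℤ), monomial s' (coeff s' Δ)) ≤
      (δ * d + 1) ^ k * (s + 2) := by
  classical
  have hdet : ∀ J : Fin k → Fin (δ * d + 1),
      (Matrix.diagonal fun i => ((J i : ℕ) : ℂ) + 2).det ≠ 0 := by
    intro J
    rw [Matrix.det_diagonal]
    refine Finset.prod_ne_zero_iff.2 fun i _ => ?_
    have : ((J i : ℕ) : ℂ) + 2 = (((J i : ℕ) + 2 : ℕ) : ℂ) := by push_cast; ring
    rw [this]
    exact Nat.cast_ne_zero.2 (Nat.succ_ne_zero _)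
  rw [weightPart_eq_sum_coordRep Δ hΔ ν hdet]
  refine (affComplexity_sum_smul_le _ _ _).trans ?_
  calc ∑ J : Fin k → Fin (δ * d + 1), (affComplexity (coordRep (Fin k) ℂ d
          (Matrix.GeneralLinearGroup.mkOfDetNeZero (Matrix.diagonal fun i => ((J i : ℕ) : ℂ) + 2)
            (hdet J)) Δ) + 2)
        ≤ ∑ J : Fin k → Fin (δ * d + 1), (s + 2) :=
          Finset.sum_le_sum fun J _ => Nat.add_le_add_right
            ((affComplexity_coordRep_le Δ _).trans hs) 2
    _ = (δ * d + 1) ^ k * (s + 2) := by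
          rw [Finset.sum_const, Finset.card_univ, Fintype.card_fun, Fintype.card_fin,
            Fintype.card_fin, smul_eq_mul]

/-- The arithmetic of the final bound: `(M+1)^k (s+2) ≤ 3 s M^{2k³}` for `M ≥ 2`, `s ≥ 1`.
[cite: BergEtAl2024, Thm. 1.1 (1), p.4 (PDF p.5)] -/
theorem interpolation_cost_le {M k s : ℕ} (hM : 2 ≤ M) (hs : 1 ≤ s) :
    (M + 1) ^ k * (s + 2) ≤ 3 * s * M ^ (2 * k ^ 3) := by
  have h1 : M + 1 ≤ M ^ 2 := by nlinarith
  have h2 : (M + 1) ^ k ≤ M ^ (2 * k) := by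
    rw [pow_mul]
    exact Nat.pow_le_pow_left h1 k
  have hk : k ≤ k ^ 3 := Nat.le_self_pow (by norm_num) k
  have h3 : M ^ (2 * k) ≤ M ^ (2 * k ^ 3) := Nat.pow_le_pow_right (by omega) (by omega)
  have h4 : s + 2 ≤ 3 * s := by omega
  calc (M + 1) ^ k * (s + 2) ≤ M ^ (2 * k ^ 3) * (3 * s) := Nat.mul_le_mul (h2.trans h3) h4
    _ = 3 * s * M ^ (2 * k ^ 3) := by ring

end Final

/-- **van den Berg–Dutta–Gesmundo–Ikenmeyer–Lysikov 2024, Theorem 1.1 (1) holds** (with the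
absolute constant `C = 3`): the weight-space projections of a metapolynomial of format
`(δ, d, k)` and `cc ≤ s` have `cc ≤ 3 · s · (δd)^{2k³}`. Discharge of the named fact
`BergEtAl2024.thm_1_1_weight`; the projection is the explicit weight part, the bound is torus
interpolation (module docstring). [cite: BergEtAl2024, Thm. 1.1 (1), p.4 (PDF p.5)] -/
theorem thm_1_1_weight_holds : thm_1_1_weight := by
  refine ⟨3, fun δ d k s Δ hd hΔ hs χ => ?_⟩
  classical
  refine ⟨∑ s' ∈ Δ.support with monWeight s' = χ, monomial s' (coeff s' Δ),
    weightPart_mem_weightSpace Δ χ, sub_weightPart_mem Δ χ, ?_⟩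
  -- affine metapolynomials: the projection is affine, hence free
  by_cases haff : Δ.totalDegree ≤ 1
  · rw [affComplexity_eq_zero_of_totalDegree_le_one ((totalDegree_weightPart_le Δ χ).trans haff)]
    exact Nat.zero_le _
  have hs1 : 1 ≤ s := by
    by_contra h0
    exact haff (totalDegree_le_one_of_affComplexity_eq_zero (by omega))
  have hδ : 2 ≤ δ := by
    by_contra h
    exact haff (hΔ.totalDegree_le.trans (by omega))
  by_cases hbox : ∃ ν : Fin k → Fin (δ * d + 1), χ = fun i => -((ν i : ℕ) : ℤ)
  · -- weights in the box: interpolate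
    obtain ⟨ν, rfl⟩ := hbox
    refine (affComplexity_weightPart_le_of_box Δ hΔ hs ν).trans ?_
    exact interpolation_cost_le (by nlinarith) hs1
  · -- weights outside the box do not occur
    have hempty : (Δ.support.filter fun s' => monWeight s' = χ) = ∅ := by
      refine Finset.filter_eq_empty_iff.2 fun s' hs' hw => hbox ⟨fun i =>
        ⟨∑ μ ∈ s'.support, s' μ * μ.1 i, Nat.lt_succ_of_le (occupation_le hΔ hs' i)⟩, ?_⟩
      rw [← hw]
      funext i
      rw [monWeight_apply]
    rw [hempty, Finset.sum_empty]
    have h0 : (0 : MvPolynomial (DegIdx (Fin k) d) ℂ).totalDegree ≤ 1 := by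
      rw [totalDegree_zero]; exact Nat.zero_le _
    rw [affComplexity_eq_zero_of_totalDegree_le_one h0]
    exact Nat.zero_le _

end BergEtAl2024

end Literature.Barriers.ValiantsHypothesis

end
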